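import Mathlib.Algebra.Group.Basic
import Mathlib.Algebra.Module.Defs
import Mathlib.Data.Nat.Choose.Basic
import Mathlib.Data.Real.Basic
import Mathlib.Tactic

/-!
# Route `GreenTaoLevelTwo`, crux `MNTwo` (stmt-Parity-21276), line `birth`, stub `stub_mnVertical`:
# the algebra of locally quadratic phases on gauge balls (GT 2008b §9, (taylor), (bilinear), Cor. 20)

Tool for blocks V4–V6 of the `stub_mnVertical` census (B. Green, T. Tao, *Quadratic uniformity of
the Möbius function*, Ann. Inst. Fourier 58 (2008) = arXiv:math/0606087, §2 Def. 3 (locally quadratic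
phases: the alternating sum over every `3`-cube inside `S` vanishes) and §9 "Locally quadratic phase
functions, II": for `φ` locally quadratic on the Bohr set `B_g(n₀, 100ρ₀)` one defines
`φ''(h₁,h₂) := φ(n₀+h₁+h₂) − φ(n₀+h₁) − φ(n₀+h₂) + φ(n₀)` and has the "Taylor expansion" (taylor)
`φ''(h₁,h₂) = φ(n+h₁+h₂) − φ(n+h₁) − φ(n+h₂) + φ(n)` for `n ∈ B_g(n₀,40ρ₀)`, `‖hᵢ‖_g ≤ 30ρ₀`, the
local bilinearity (bilinear), and Cor. 20 "Explicit quadratic structure":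
`φ(n+hl) = ½l(l−1)φ''(h,h) + αl + β`).

ABSTRACT, def-free form: the Bohr "norm" `‖·‖_g` is replaced by an arbitrary gauge `ν : ℤ → ℝ` with
`ν 0 = 0`, `ν(−x) = ν x`, `ν(x+y) ≤ ν x + ν y` (the rotation Bohr gauge
`maxᵢ ‖nαᵢ‖_{ℝ/ℤ} + |n|/N` of `…MNTwoRotationBohrSize` is one), the phase takes values in any
additive commutative group (`ℝ/ℤ` in the paper), and "locally quadratic on `B(n₀,R) = {ν(· − n₀) < R}`"
is the explicit eight-point hypothesis `hφ`.  Radii are kept as free parameters with the one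
constraint that all points used lie in the ball.

* `gauge_nsmul_le`, `gauge_add_three_le` — gauge bookkeeping;
* `second_diff_eq_second_diff_center` — (taylor);
* `second_deriv_add_left`, `second_deriv_comm`, `second_deriv_nsmul_left` — (bilinear) and its
  iterate `φ''(jh, h') = j φ''(h, h')`;
* `phase_on_progression` — Cor. 20: `φ(n + lh) = (l choose 2) φ''(h,h) + l (φ(n+h) − φ(n)) + φ(n)`.

References: [GreenTao2008QuadraticMobius] arXiv:math/0606087 §2 Def. 3, §9 eq. (taylor), (bilinear),
Corollary 20.
-/

namespace Summit.Parity.GeneralizedHardyLittlewood.GreenTaoLevelTwoMNTwoLocalQuadratic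

variable {G : Type*} [AddCommGroup G]

/-! ### §1 Gauge bookkeeping -/

/-- Multiples: `ν(j h) ≤ j ν(h)` for a subadditive gauge with `ν 0 = 0`. [folklore] -/
theorem gauge_nsmul_le (ν : ℤ → ℝ) (hν0 : ν 0 = 0) (hνadd : ∀ x y, ν (x + y) ≤ ν x + ν y)
    (h : ℤ) (j : ℕ) : ν ((j : ℤ) * h) ≤ j * ν h := by
  induction j with
  | zero => simp [hν0]
  | succ j ih =>
    have e : (((j + 1 : ℕ) : ℤ)) * h = (j : ℤ) * h + h := by push_cast; ring
    rw [e]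
    calc ν ((j : ℤ) * h + h) ≤ ν ((j : ℤ) * h) + ν h := hνadd _ _
      _ ≤ j * ν h + ν h := by linarith
      _ = ((j + 1 : ℕ) : ℝ) * ν h := by push_cast; ring

/-- Three-term bookkeeping: `ν(a + b + c) ≤ ν a + ν b + ν c`. [folklore] -/
theorem gauge_add_three_le (ν : ℤ → ℝ) (hνadd : ∀ x y, ν (x + y) ≤ ν x + ν y) (a b c : ℤ) :
    ν (a + b + c) ≤ ν a + ν b + ν c := by
  have := hνadd (a + b) c; have := hνadd a b; linarith

/-! ### §2 (taylor): the second difference is independent of the base point -/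

/-- **(taylor).**  Let `φ` be locally quadratic on the gauge ball `B(n₀, R)` (hypothesis `hφ`: the
alternating sum of `φ` over every `3`-cube contained in the ball vanishes).  If `ν(n − n₀) < r₁`,
`ν h₁ < r₂`, `ν h₂ < r₂` and `r₁ + 2r₂ ≤ R`, then
`φ(n+h₁+h₂) − φ(n+h₁) − φ(n+h₂) + φ(n) = φ(n₀+h₁+h₂) − φ(n₀+h₁) − φ(n₀+h₂) + φ(n₀)`.
[cite: GreenTao2008QuadraticMobius, §9 eq. (taylor)] -/
theorem second_diff_eq_second_diff_center (ν : ℤ → ℝ) (hν0 : ν 0 = 0) (hνnn : ∀ x, 0 ≤ ν x)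
    (hνadd : ∀ x y, ν (x + y) ≤ ν x + ν y) (φ : ℤ → G) {n₀ : ℤ} {R : ℝ}
    (hφ : ∀ n a b c : ℤ, ν (n - n₀) < R → ν (n + a - n₀) < R → ν (n + b - n₀) < R →
      ν (n + c - n₀) < R → ν (n + a + b - n₀) < R → ν (n + a + c - n₀) < R →
      ν (n + b + c - n₀) < R → ν (n + a + b + c - n₀) < R →
      φ (n + a + b + c) - φ (n + a + b) - φ (n + a + c) - φ (n + b + c)
        + φ (n + a) + φ (n + b) + φ (n + c) - φ n = 0)
    {n h₁ h₂ : ℤ} {r₁ r₂ : ℝ} (hn : ν (n - n₀) < r₁) (hh₁ : ν h₁ < r₂) (hh₂ : ν h₂ < r₂)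
    (hR : r₁ + 2 * r₂ ≤ R) :
    φ (n + h₁ + h₂) - φ (n + h₁) - φ (n + h₂) + φ n =
      φ (n₀ + h₁ + h₂) - φ (n₀ + h₁) - φ (n₀ + h₂) + φ n₀ := by
  have hν0' : 0 ≤ ν h₁ := hνnn _
  have hνh₂ : 0 ≤ ν h₂ := hνnn _
  have hr₁ : 0 ≤ r₁ := (hνnn _).trans hn.le
  -- the cube based at `n₀` with edges `h₁, h₂, n − n₀`
  have key := hφ n₀ h₁ h₂ (n - n₀)
    (by rw [sub_self, hν0]; linarith)
    (by rw [add_sub_cancel_left]; linarith)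
    (by rw [add_sub_cancel_left]; linarith)
    (by rw [show n₀ + (n - n₀) - n₀ = n - n₀ by ring]; linarith)
    (by rw [show n₀ + h₁ + h₂ - n₀ = h₁ + h₂ by ring]; linarith [hνadd h₁ h₂])
    (by rw [show n₀ + h₁ + (n - n₀) - n₀ = h₁ + (n - n₀) by ring]; linarith [hνadd h₁ (n - n₀)])
    (by rw [show n₀ + h₂ + (n - n₀) - n₀ = h₂ + (n - n₀) by ring]; linarith [hνadd h₂ (n - n₀)])
    (by rw [show n₀ + h₁ + h₂ + (n - n₀) - n₀ = h₁ + h₂ + (n - n₀) by ring]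
        linarith [gauge_add_three_le ν hνadd h₁ h₂ (n - n₀)])
  have e1 : n₀ + h₁ + h₂ + (n - n₀) = n + h₁ + h₂ := by ring
  have e2 : n₀ + h₁ + (n - n₀) = n + h₁ := by ring
  have e3 : n₀ + h₂ + (n - n₀) = n + h₂ := by ring
  have e4 : n₀ + (n - n₀) = n := by ring
  rw [e1, e2, e3, e4] at key
  -- `key : φ(n+h₁+h₂) − φ(n₀+h₁+h₂) − φ(n+h₁) − φ(n+h₂) + φ(n₀+h₁) + φ(n₀+h₂) + φ n − φ n₀ = 0`
  have : φ (n + h₁ + h₂) - φ (n + h₁) - φ (n + h₂) + φ n -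
      (φ (n₀ + h₁ + h₂) - φ (n₀ + h₁) - φ (n₀ + h₂) + φ n₀) = 0 := by
    rw [← key]; abel
  exact sub_eq_zero.1 this

/-! ### §3 (bilinear): local bilinearity of `φ''` -/

/-- **(bilinear), additivity in the first slot.**  With
`φ''(a,b) := φ(n₀+a+b) − φ(n₀+a) − φ(n₀+b) + φ(n₀)`: if `ν h₁, ν h₁', ν h₂ < r` and `3r ≤ R` then
`φ''(h₁+h₁', h₂) = φ''(h₁,h₂) + φ''(h₁',h₂)`.
[cite: GreenTao2008QuadraticMobius, §9 eq. (bilinear)] -/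
theorem second_deriv_add_left (ν : ℤ → ℝ) (hν0 : ν 0 = 0) (hνnn : ∀ x, 0 ≤ ν x)
    (hνadd : ∀ x y, ν (x + y) ≤ ν x + ν y) (φ : ℤ → G) {n₀ : ℤ} {R : ℝ}
    (hφ : ∀ n a b c : ℤ, ν (n - n₀) < R → ν (n + a - n₀) < R → ν (n + b - n₀) < R →
      ν (n + c - n₀) < R → ν (n + a + b - n₀) < R → ν (n + a + c - n₀) < R →
      ν (n + b + c - n₀) < R → ν (n + a + b + c - n₀) < R →
      φ (n + a + b + c) - φ (n + a + b) - φ (n + a + c) - φ (n + b + c)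
        + φ (n + a) + φ (n + b) + φ (n + c) - φ n = 0)
    {h₁ h₁' h₂ : ℤ} {r : ℝ} (hh₁ : ν h₁ < r) (hh₁' : ν h₁' < r) (hh₂ : ν h₂ < r)
    (hR : 3 * r ≤ R) :
    φ (n₀ + (h₁ + h₁') + h₂) - φ (n₀ + (h₁ + h₁')) - φ (n₀ + h₂) + φ n₀ =
      (φ (n₀ + h₁ + h₂) - φ (n₀ + h₁) - φ (n₀ + h₂) + φ n₀) +
        (φ (n₀ + h₁' + h₂) - φ (n₀ + h₁') - φ (n₀ + h₂) + φ n₀) := by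
  have h0 : 0 ≤ ν h₁ := hνnn _
  have h0' : 0 ≤ ν h₁' := hνnn _
  have h0'' : 0 ≤ ν h₂ := hνnn _
  have key := hφ n₀ h₁ h₁' h₂
    (by rw [sub_self, hν0]; linarith)
    (by rw [add_sub_cancel_left]; linarith)
    (by rw [add_sub_cancel_left]; linarith)
    (by rw [add_sub_cancel_left]; linarith)
    (by rw [show n₀ + h₁ + h₁' - n₀ = h₁ + h₁' by ring]; linarith [hνadd h₁ h₁'])
    (by rw [show n₀ + h₁ + h₂ - n₀ = h₁ + h₂ by ring]; linarith [hνadd h₁ h₂])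
    (by rw [show n₀ + h₁' + h₂ - n₀ = h₁' + h₂ by ring]; linarith [hνadd h₁' h₂])
    (by rw [show n₀ + h₁ + h₁' + h₂ - n₀ = h₁ + h₁' + h₂ by ring]
        linarith [gauge_add_three_le ν hνadd h₁ h₁' h₂])
  have e : φ (n₀ + (h₁ + h₁') + h₂) - φ (n₀ + (h₁ + h₁')) - φ (n₀ + h₂) + φ n₀ -
      ((φ (n₀ + h₁ + h₂) - φ (n₀ + h₁) - φ (n₀ + h₂) + φ n₀) +
        (φ (n₀ + h₁' + h₂) - φ (n₀ + h₁') - φ (n₀ + h₂) + φ n₀)) = 0 := by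
    rw [← key, show n₀ + (h₁ + h₁') = n₀ + h₁ + h₁' by ring]; abel
  exact sub_eq_zero.1 e

/-- `φ''` is symmetric. [folklore] -/
theorem second_deriv_comm (φ : ℤ → G) (n₀ h₁ h₂ : ℤ) :
    φ (n₀ + h₁ + h₂) - φ (n₀ + h₁) - φ (n₀ + h₂) + φ n₀ =
      φ (n₀ + h₂ + h₁) - φ (n₀ + h₂) - φ (n₀ + h₁) + φ n₀ := by
  rw [show n₀ + h₁ + h₂ = n₀ + h₂ + h₁ by ring]; abel

/-- **(bilinear), iterated: `φ''(jh, h') = j • φ''(h, h')`** when `j ν(h) < r`, `ν h < r`,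
`ν h' < r` and `3r ≤ R`. [cite: GreenTao2008QuadraticMobius, §9 eq. (bilinear)] -/
theorem second_deriv_nsmul_left (ν : ℤ → ℝ) (hν0 : ν 0 = 0) (hνnn : ∀ x, 0 ≤ ν x)
    (hνadd : ∀ x y, ν (x + y) ≤ ν x + ν y) (φ : ℤ → G) {n₀ : ℤ} {R : ℝ}
    (hφ : ∀ n a b c : ℤ, ν (n - n₀) < R → ν (n + a - n₀) < R → ν (n + b - n₀) < R →
      ν (n + c - n₀) < R → ν (n + a + b - n₀) < R → ν (n + a + c - n₀) < R →
      ν (n + b + c - n₀) < R → ν (n + a + b + c - n₀) < R →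
      φ (n + a + b + c) - φ (n + a + b) - φ (n + a + c) - φ (n + b + c)
        + φ (n + a) + φ (n + b) + φ (n + c) - φ n = 0)
    {h h' : ℤ} {r : ℝ} (j : ℕ) (hjh : (j : ℝ) * ν h < r) (hh : ν h < r) (hh' : ν h' < r)
    (hR : 3 * r ≤ R) :
    φ (n₀ + (j : ℤ) * h + h') - φ (n₀ + (j : ℤ) * h) - φ (n₀ + h') + φ n₀ =
      j • (φ (n₀ + h + h') - φ (n₀ + h) - φ (n₀ + h') + φ n₀) := by
  have hνh : 0 ≤ ν h := hνnn _
  induction j with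
  | zero => simp
  | succ j ih =>
    have hj' : (j : ℝ) * ν h < r := by
      have : (j : ℝ) * ν h ≤ ((j + 1 : ℕ) : ℝ) * ν h := by
        push_cast; nlinarith
      linarith
    have hmul : ν ((j : ℤ) * h) < r := lt_of_le_of_lt (gauge_nsmul_le ν hν0 hνadd h j) hj'
    have step := second_deriv_add_left ν hν0 hνnn hνadd φ hφ hmul hh hh' hR
    have e : (((j + 1 : ℕ) : ℤ)) * h = (j : ℤ) * h + h := by push_cast; ring
    rw [e, step, ih hj', succ_nsmul]

/-! ### §4 Cor. 20: explicit quadratic structure along short progressions -/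

/-- **Explicit quadratic structure (GT 2008b Cor. 20).**  Let `φ` be locally quadratic on the
gauge ball `B(n₀, R)`, and let `n, h, L` satisfy `ν(n − n₀) + L ν(h) < r₁` (so that all the base
points `n + lh`, `l ≤ L`, lie in `B(n₀, r₁)`), `ν h < r₂` and `r₁ + 2 r₂ ≤ R`.  Then for all `l ≤ L`:
`φ(n + l h) = (l choose 2) • φ''(h,h) + l • (φ(n+h) − φ(n)) + φ(n)`, where
`φ''(h,h) = φ(n₀+2h) − 2φ(n₀+h) + φ(n₀)` ("`φ` is a genuine quadratic on short progressions").
[cite: GreenTao2008QuadraticMobius, Corollary 20] -/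
theorem phase_on_progression (ν : ℤ → ℝ) (hν0 : ν 0 = 0) (hνnn : ∀ x, 0 ≤ ν x)
    (hνadd : ∀ x y, ν (x + y) ≤ ν x + ν y) (φ : ℤ → G) {n₀ : ℤ} {R : ℝ}
    (hφ : ∀ n a b c : ℤ, ν (n - n₀) < R → ν (n + a - n₀) < R → ν (n + b - n₀) < R →
      ν (n + c - n₀) < R → ν (n + a + b - n₀) < R → ν (n + a + c - n₀) < R →
      ν (n + b + c - n₀) < R → ν (n + a + b + c - n₀) < R →
      φ (n + a + b + c) - φ (n + a + b) - φ (n + a + c) - φ (n + b + c)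
        + φ (n + a) + φ (n + b) + φ (n + c) - φ n = 0)
    {n h : ℤ} {r₁ r₂ : ℝ} {L : ℕ} (hn : ν (n - n₀) + L * ν h < r₁) (hh : ν h < r₂)
    (hR : r₁ + 2 * r₂ ≤ R) :
    ∀ l : ℕ, l ≤ L →
      φ (n + (l : ℤ) * h) = (l.choose 2) • (φ (n₀ + h + h) - φ (n₀ + h) - φ (n₀ + h) + φ n₀) +
        l • (φ (n + h) - φ n) + φ n := by
  have hνh : 0 ≤ ν h := hνnn _
  -- the base points `n + l h`, `l ≤ L`, stay in `B(n₀, r₁)`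
  have hbase : ∀ l : ℕ, l ≤ L → ν (n + (l : ℤ) * h - n₀) < r₁ := by
    intro l hl
    have h1 : ν (n + (l : ℤ) * h - n₀) ≤ ν (n - n₀) + ν ((l : ℤ) * h) := by
      rw [show n + (l : ℤ) * h - n₀ = (n - n₀) + (l : ℤ) * h by ring]; exact hνadd _ _
    have h2 := gauge_nsmul_le ν hν0 hνadd h l
    have h3 : (l : ℝ) * ν h ≤ L * ν h := by
      have : (l : ℝ) ≤ L := by exact_mod_cast hl
      nlinarith
    linarith
  -- two-step induction via the recurrence `φ(m+2h) − 2φ(m+h) + φ(m) = φ''(h,h)`, `m = n + lh`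
  intro l
  induction l using Nat.twoStepInduction with
  | zero => intro _; simp
  | one => intro _; simp
  | more l h0 h1 =>
    intro hl
    have e0 := h0 (by omega)
    have e1 := h1 (by omega)
    have hrec := second_diff_eq_second_diff_center ν hν0 hνnn hνadd φ hφ (hbase l (by omega)) hh hh hR
    have c2 : n + ((l + 2 : ℕ) : ℤ) * h = n + (l : ℤ) * h + h + h := by push_cast; ring
    have c1 : n + ((l + 1 : ℕ) : ℤ) * h = n + (l : ℤ) * h + h := by push_cast; ring
    rw [c1] at e1
    rw [c2]
    have expr : φ (n + (l : ℤ) * h + h + h) =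
        (φ (n₀ + h + h) - φ (n₀ + h) - φ (n₀ + h) + φ n₀) + φ (n + (l : ℤ) * h + h) +
          φ (n + (l : ℤ) * h + h) - φ (n + (l : ℤ) * h) := by
      rw [← hrec]; abel
    have h3 : (l + 1).choose 2 = l.choose 1 + l.choose 2 := Nat.choose_succ_succ l 1
    have h2 : (l + 2).choose 2 = (l + 1).choose 1 + (l + 1).choose 2 := Nat.choose_succ_succ (l + 1) 1
    rw [Nat.choose_one_right] at h2 h3
    have hc : (l + 2).choose 2 = l.choose 2 + l + (l + 1) := by omega
    have hc1 : (l + 1).choose 2 = l.choose 2 + l := by omega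
    rw [expr, e1, e0, hc, hc1]
    simp only [add_nsmul, one_nsmul]
    abel

end Summit.Parity.GeneralizedHardyLittlewood.GreenTaoLevelTwoMNTwoLocalQuadratic
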